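import Summits.NavierStokesRegularity.NavierStokesRegularity.Theorems.PerpetualPumpAveragedTypeIBlowupChainCriticalTools
import Summits.NavierStokesRegularity.NavierStokesRegularity.Theorems.PerpetualPumpAveragedTypeIBlowupKernelDeriv
import Summits.NavierStokesRegularity.NavierStokesRegularity.Theorems.PerpetualPumpAveragedTypeIBlowupTodaLegal

/-!
# Crux `PerpetualPump.AveragedTypeIBlowup` (stmt-NavierStokesRegularity-1835), line `Sketch`:
# the stub `chainCritical` — the chain, in critical variables, is the critical Toda system with
# memory errors

T. Tao, *Finite time blowup for an averaged three-dimensional Navier–Stokes equation*, J. Amer.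
Math. Soc. **29** (2016), 601–674 = arXiv:1402.0290v3, §4, p. 22 (4.14): the exact Volterra chain
`Y_{i,n}(t) = A 1_{(i,n)=(i₀,n₀)} k_{i,n}(t) + ∫₀ᵗ k_{i,n}(t-s) quadTerm(Y)_{i,n}(s) ds` of the wavelet
coefficients, with the mode heat kernels `k_{i,n}(τ) = Re⟨e^{τΔ}ψ_{i,n}, ψ_{i,n}⟩`.

This file proves the registered stub `stub_chainCritical` of the lead's skeleton
`Cruxes/AveragedTypeIBlowup/Lines/Sketch.lean`, verbatim: the Layer-1 → Layer-2 BRIDGE. For thin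
wavelet data (radius `≤ r`, centres on `|ξ| = ρ₀ = 1 + ε₀/4`) and the seeded Toda structure constants
(Toda coupling `D_c = 4π²(ρ₀² + r²)`, seed `ε̄ D_c`), a continuous chain solution from the carrier datum
`A` at scale `n₀` is, in the critical variables `b_n = −(1+ε₀)^{n/2} Y₀,ₙ`, `w_n = (1+ε₀)^{n/2} Y₁,ₙ`
and with the critical kernel majorants `M0, M1`, a solution of the critical Toda system with memory
errors: `b' = R(−b + w₋²/q³ − w² − ε̄bw) + e`, `w' = R(−w + w(b − b₊/q) + ε̄b²) + e`, `|e| ≤ ηRM`,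
`R_n = D_c(1+ε₀)^{2n}`, `η = 2ρ₀r/(ρ₀²+r²)`; `|b| ≤ M0`, `|w| ≤ M1`; the restart inequality of the
majorants at rate `θR`, `θ = (ρ₀−r)²/(ρ₀²+r²)`; and the initial/vanishing values.

The proof is bookkeeping over the accepted stubs: `stub_kernelDeriv` (the kernels agree on `τ ≥ 0`
with smooth frequency integrals `K`, `K' = -K₁`, pinched as
`4π²(ρ₀-r)²(1+ε₀)^{2n} K ≤ K₁ ≤ 4π²(ρ₀+r)²(1+ε₀)^{2n} K`, so that `½(D⁻+D⁺) = R`, `½(D⁺-D⁻) = ηR`,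
`D⁻ = θR`), `stub_kernel` (`K(0) = 1`), `stub_chainODE` (the chain ODE with central damping and
memory error, through the explicit derivative of the tools file), `stub_todaLegal` (the closed forms
`Q₀,ₙ = cλₙY₁,ₙ² − cλₙ₋₁Y₁,ₙ₋₁² − ε̄cλₙY₀,ₙY₁,ₙ`, `Q₁,ₙ = cλₙY₁,ₙ(Y₀,ₙ₊₁ − Y₀,ₙ) + ε̄cλₙY₀,ₙ²`), and the
scale-weight algebra `λₙ(1+ε₀)^{-n/2} = (1+ε₀)^{2n}`, `λₙ₋₁(1+ε₀)^{-(n−1)}(1+ε₀)^{n/2} = (1+ε₀)^{2n}/q³`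
of `chainCritical_weight_identities`, packaged as the registered sub-goal `stub_chainCriticalAlgebra`. The
abstract-kernel form is `chainCritical_of_kernels`.

Nothing here closes the item (`--supports`); no statement of the route changes.

## References

* T. Tao, J. Amer. Math. Soc. 29 (2016), 601–674, arXiv:1402.0290v3, §4 (4.14). [`Tao2016AveragedNS`]
-/

noncomputable section

-- the summit namespace `…NavierStokesRegularity.NavierStokesRegularity…` is the tree convention
set_option linter.dupNamespace false

open MeasureTheory Set Filter Topology
open scoped ENNReal
open Literature.Analysis.FluidPDE Literature.Analysis.FluidPDE.Tao2016
open Literature.Analysis.FluidPDE.TaoCascade (quadTerm IsSymmetricCoeff IsCancellingCoeff)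

namespace Summit.NavierStokesRegularity.NavierStokesRegularity.Theorems.PerpetualPumpAveragedTypeIBlowup

variable {ε₀ : ℝ}

/-- **Registered sub-goal `stub_chainCriticalAlgebra`: the key algebra of the bridge.** With
`L = 1+ε₀`, `Pₙ = L^{n/2}`, `λₙ = L^{5n/2}`, `q = √L`, `Rₙ = cL^{2n}`, `b = -PₙY₀`, `w = PₙY₁`: the Toda
closed forms of the drive become the critical nonlinearities (carrier and bond),
`-Pₙ(cλₙY₁,ₙ² − cλₙ₋₁Y₁,ₙ₋₁² − ε̄cλₙY₀,ₙY₁,ₙ) = Rₙ(wₙ₋₁²/q³ − wₙ² − ε̄bₙwₙ)`,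
`Pₙ(cλₙY₁,ₙ(Y₀,ₙ₊₁ − Y₀,ₙ) + ε̄cλₙY₀,ₙ²) = Rₙ(wₙ(bₙ − bₙ₊₁/q) + ε̄bₙ²)` (scale-weight identities). [folklore] -/
theorem stub_chainCriticalAlgebra :
    ∀ {L : ℝ}, 0 < L → ∀ (c εb y0 y0p y1 y1m : ℝ) (n : ℤ),
      -(L ^ ((n : ℝ) / 2) * (c * L ^ ((5 : ℝ) * (n : ℝ) / 2) * y1 ^ 2 -
          c * L ^ ((5 : ℝ) * ((n : ℝ) - 1) / 2) * y1m ^ 2 -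
          εb * c * L ^ ((5 : ℝ) * (n : ℝ) / 2) * (y0 * y1))) =
        c * L ^ (2 * n) * ((L ^ (((n - 1 : ℤ) : ℝ) / 2) * y1m) ^ 2 / Real.sqrt L ^ 3 -
          (L ^ ((n : ℝ) / 2) * y1) ^ 2 - εb * -(L ^ ((n : ℝ) / 2) * y0) * (L ^ ((n : ℝ) / 2) * y1)) ∧
      L ^ ((n : ℝ) / 2) * (c * L ^ ((5 : ℝ) * (n : ℝ) / 2) * (y1 * (y0p - y0)) +
          εb * c * L ^ ((5 : ℝ) * (n : ℝ) / 2) * y0 ^ 2) =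
        c * L ^ (2 * n) * (L ^ ((n : ℝ) / 2) * y1 *
          (-(L ^ ((n : ℝ) / 2) * y0) - -(L ^ (((n + 1 : ℤ) : ℝ) / 2) * y0p) / Real.sqrt L) +
          εb * (-(L ^ ((n : ℝ) / 2) * y0)) ^ 2) := by
  intro L hL c εb y0 y0p y1 y1m n
  obtain ⟨h1, h2, h3⟩ := chainCritical_weight_identities hL n
  exact ⟨by linear_combination (-c * y1 ^ 2 + εb * c * (y0 * y1)) * h1 + c * y1m ^ 2 * h2,
    by linear_combination (-c * y1 * y0 + εb * c * y0 ^ 2) * h1 + c * y1 * y0p * h3⟩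

/-! ### The critical Toda system with memory errors, abstract kernels -/

/-- **The critical system from the chain, abstract smooth kernels.** Let `Y` solve the seeded-Toda
chain on `[0,S)` from the carrier datum `A` at scale `n₀`, with kernels `κ` agreeing on `τ ≥ 0` with `C¹`
kernels `K` (`K' = -K₁`, `K(0) = 1`) pinched as `D⁻ₙ K ≤ K₁ ≤ D⁺ₙ K`, `K ≥ 0`, where `D⁻ₙ + D⁺ₙ = 2Rₙ`,
`D⁺ₙ - D⁻ₙ = 2ηRₙ`, `D⁻ₙ = θRₙ`, `Rₙ = c(1+ε₀)^{2n}`, and let the drive have the Toda closed forms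
of `stub_todaLegal`. Then `b = −(1+ε₀)^{n/2}Y₀`, `w = (1+ε₀)^{n/2}Y₁` with their kernel majorants `M`
solve the critical Toda system with memory errors `|e| ≤ ηRM`, `|b| ≤ M`, the restart inequality at
rate `θR`, and the stated initial/vanishing values. [cite: Tao2016AveragedNS, §4 p. 22 (4.14)] -/
theorem chainCritical_of_kernels (hε₀ : 0 < ε₀) {α : Fin 2 → Fin 2 → Fin 2 → ℤ × ℤ × ℤ → ℝ}
    {κ K K₁ : Fin 2 → ℤ → ℝ → ℝ} {Dlo Dhi R : ℤ → ℝ} {θ η q c εb : ℝ} {n₀ : ℤ} {A S : ℝ}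
    {Y : Fin 2 → ℤ → ℝ → ℝ} {bv wv G0 G1 M0 M1 : ℤ → ℝ → ℝ}
    (hκ : ∀ i n τ, 0 ≤ τ → κ i n τ = K i n τ)
    (hK : ∀ i n τ, HasDerivAt (K i n) (-K₁ i n τ) τ) (hK₁ : ∀ i n, Continuous (K₁ i n))
    (hK0 : ∀ i n, K i n 0 = 1)
    (hpinch : ∀ (i : Fin 2) (n : ℤ) (τ : ℝ), 0 ≤ τ →
      0 ≤ K i n τ ∧ Dlo n * K i n τ ≤ K₁ i n τ ∧ K₁ i n τ ≤ Dhi n * K i n τ)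
    (hsum : ∀ n, Dlo n + Dhi n = 2 * R n) (hdiff : ∀ n, Dhi n - Dlo n = 2 * (η * R n))
    (hθ : ∀ n, Dlo n = θ * R n) (hc : 0 < c) (hR : ∀ n, R n = c * (1 + ε₀) ^ (2 * n))
    (hq : q = Real.sqrt (1 + ε₀))
    (hYc : ∀ i n, ContinuousOn (Y i n) (Ico 0 S)) (hlow : ∀ i n t, n < n₀ → Y i n t = 0)
    (hchain : ∀ (i : Fin 2) (n : ℤ), ∀ t ∈ Ico 0 S,
      Y i n t = (if i = 0 ∧ n = n₀ then A else 0) * κ i n t +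
        ∫ s in (0 : ℝ)..t, κ i n (t - s) * quadTerm ε₀ α Y i n s)
    (hQ0 : ∀ n t, quadTerm ε₀ α Y 0 n t =
      c * (1 + ε₀) ^ ((5 : ℝ) * (n : ℝ) / 2) * Y 1 n t ^ 2 -
        c * (1 + ε₀) ^ ((5 : ℝ) * ((n : ℝ) - 1) / 2) * Y 1 (n - 1) t ^ 2 -
        εb * c * (1 + ε₀) ^ ((5 : ℝ) * (n : ℝ) / 2) * (Y 0 n t * Y 1 n t))
    (hQ1 : ∀ n t, quadTerm ε₀ α Y 1 n t =
      c * (1 + ε₀) ^ ((5 : ℝ) * (n : ℝ) / 2) * (Y 1 n t * (Y 0 (n + 1) t - Y 0 n t)) +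
        εb * c * (1 + ε₀) ^ ((5 : ℝ) * (n : ℝ) / 2) * Y 0 n t ^ 2)
    (hbv : ∀ n t, bv n t = -((1 + ε₀) ^ ((n : ℝ) / 2) * Y 0 n t))
    (hwv : ∀ n t, wv n t = (1 + ε₀) ^ ((n : ℝ) / 2) * Y 1 n t)
    (hG0 : ∀ k t, G0 k t = (wv (k - 1) t) ^ 2 / q ^ 3 - (wv k t) ^ 2 - εb * bv k t * wv k t)
    (hG1 : ∀ k t, G1 k t = wv k t * (bv k t - bv (k + 1) t / q) + εb * (bv k t) ^ 2)
    (hM0 : ∀ n t, M0 n t = (1 + ε₀) ^ ((n : ℝ) / 2) *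
      ((if n = n₀ then |A| else 0) * K 0 n t +
        ∫ s in (0 : ℝ)..t, K 0 n (t - s) * |quadTerm ε₀ α Y 0 n s|))
    (hM1 : ∀ n t, M1 n t = (1 + ε₀) ^ ((n : ℝ) / 2) *
      (∫ s in (0 : ℝ)..t, K 1 n (t - s) * |quadTerm ε₀ α Y 1 n s|))
    {T : ℝ} (hT : 0 < T) (hTS : T < S) :
    (∀ k : ℤ, k < n₀ → ∀ t ∈ Icc 0 T, bv k t = 0 ∧ wv k t = 0 ∧ M0 k t = 0 ∧ M1 k t = 0) ∧
    (∀ k : ℤ, ContinuousOn (bv k) (Icc 0 T) ∧ ContinuousOn (wv k) (Icc 0 T) ∧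
      ContinuousOn (M0 k) (Icc 0 T) ∧ ContinuousOn (M1 k) (Icc 0 T)) ∧
    (∀ k : ℤ, ∀ t ∈ Ioo 0 T, ∃ e : ℝ, |e| ≤ η * R k * M0 k t ∧
      HasDerivAt (bv k) (R k * (-(bv k t) + G0 k t) + e) t) ∧
    (∀ k : ℤ, ∀ t ∈ Ioo 0 T, ∃ e : ℝ, |e| ≤ η * R k * M1 k t ∧
      HasDerivAt (wv k) (R k * (-(wv k t) + G1 k t) + e) t) ∧
    (∀ k : ℤ, ∀ t ∈ Icc 0 T, |bv k t| ≤ M0 k t ∧ |wv k t| ≤ M1 k t ∧ 0 ≤ M0 k t ∧ 0 ≤ M1 k t) ∧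
    (∀ k : ℤ, ∀ t₁ ∈ Icc 0 T, ∀ t₂ ∈ Icc t₁ T,
      M0 k t₂ ≤ M0 k t₁ * Real.exp (-(θ * R k * (t₂ - t₁))) +
        R k * ∫ u in t₁..t₂, Real.exp (-(θ * R k * (t₂ - u))) * |G0 k u| ∧
      M1 k t₂ ≤ M1 k t₁ * Real.exp (-(θ * R k * (t₂ - t₁))) +
        R k * ∫ u in t₁..t₂, Real.exp (-(θ * R k * (t₂ - u))) * |G1 k u|) ∧
    (M0 n₀ 0 = (1 + ε₀) ^ ((n₀ : ℝ) / 2) * |A| ∧ ∀ k : ℤ, k ≠ n₀ → M0 k 0 = 0) ∧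
    (∀ k : ℤ, M1 k 0 = 0) := by
  have hL : 0 < 1 + ε₀ := by linarith
  -- the chain with the smooth kernels
  have hchainK : ∀ (i : Fin 2) (n : ℤ), ∀ t ∈ Ico 0 S,
      Y i n t = (if i = 0 ∧ n = n₀ then A else 0) * K i n t +
        ∫ s in (0 : ℝ)..t, K i n (t - s) * quadTerm ε₀ α Y i n s := by
    intro i n t ht
    rw [hchain i n t ht, hκ i n t ht.1]
    congr 1
    refine intervalIntegral.integral_congr fun s hs => ?_
    rw [uIcc_of_le ht.1] at hs
    simp only [hκ i n (t - s) (sub_nonneg.2 hs.2)]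
  have hKc : ∀ i n, Continuous (K i n) := fun i n =>
    continuous_iff_continuousAt.2 fun τ => (hK i n τ).continuousAt
  have hKnn : ∀ (i : Fin 2) (n : ℤ) (τ : ℝ), 0 ≤ τ → 0 ≤ K i n τ := fun i n τ hτ => (hpinch i n τ hτ).1
  have hQc : ∀ (i : Fin 2) (n : ℤ), ContinuousOn (fun s => quadTerm ε₀ α Y i n s) (Ico 0 S) :=
    fun i n => quadTerm_continuousOn α hYc i n
  have hP : ∀ n : ℤ, 0 < (1 + ε₀) ^ ((n : ℝ) / 2) := fun n => Real.rpow_pos_of_pos hL _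
  have hRpos : ∀ n, 0 < R n := fun n => by rw [hR]; exact mul_pos hc (zpow_pos hL _)
  have hIco : Icc 0 T ⊆ Ico 0 S := Icc_subset_Ico_right hTS
  -- the key algebra: `-(1+ε₀)^{n/2} Q₀ = R G0`, `(1+ε₀)^{n/2} Q₁ = R G1`
  have hkey0 : ∀ (n : ℤ) (t : ℝ),
      -((1 + ε₀) ^ ((n : ℝ) / 2) * quadTerm ε₀ α Y 0 n t) = R n * G0 n t := by
    intro n t
    have h := (stub_chainCriticalAlgebra hL c εb (Y 0 n t) (Y 0 (n + 1) t) (Y 1 n t)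
      (Y 1 (n - 1) t) n).1
    simp only [hQ0, hG0, hwv, hbv, hR, hq]
    linear_combination h
  have hkey1 : ∀ (n : ℤ) (t : ℝ),
      (1 + ε₀) ^ ((n : ℝ) / 2) * quadTerm ε₀ α Y 1 n t = R n * G1 n t := by
    intro n t
    have h := (stub_chainCriticalAlgebra hL c εb (Y 0 n t) (Y 0 (n + 1) t) (Y 1 n t)
      (Y 1 (n - 1) t) n).2
    simp only [hQ1, hG1, hwv, hbv, hR, hq]
    linear_combination h
  -- the datum coefficients
  have ha0 : ∀ n : ℤ, |(if (0 : Fin 2) = 0 ∧ n = n₀ then A else 0)| = if n = n₀ then |A| else 0 := by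
    intro n
    by_cases h : n = n₀ <;> simp [h]
  have ha1 : ∀ n : ℤ, (if (1 : Fin 2) = 0 ∧ n = n₀ then A else 0) = 0 := by
    intro n
    simp [show (1 : Fin 2) ≠ 0 by decide]
  refine ⟨?_, ?_, ?_, ?_, ?_, ?_, ⟨?_, ?_⟩, ?_⟩
  · -- vanishing below `n₀`
    intro k hk t _
    have hY0 : ∀ (i : Fin 2) (s : ℝ), Y i k s = 0 := fun i s => hlow i k s hk
    have hq0 : ∀ (i : Fin 2) (s : ℝ), quadTerm ε₀ α Y i k s = 0 := fun i s =>
      quadTerm_eq_zero_of_lt α hlow i hk s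
    simp only [hbv, hwv, hM0, hM1, hY0, hq0, if_neg hk.ne, abs_zero, mul_zero, zero_mul,
      intervalIntegral.integral_zero, add_zero, neg_zero, and_self]
  · -- continuity
    intro k
    have hYk : ∀ i, ContinuousOn (Y i k) (Icc 0 T) := fun i => (hYc i k).mono hIco
    have hV : ∀ i : Fin 2, ContinuousOn
        (fun t => ∫ s in (0 : ℝ)..t, K i k (t - s) * |quadTerm ε₀ α Y i k s|) (Icc 0 T) :=
      fun i => chainCritical_volterra_continuousOn (hKc i k) hT.le ((hQc i k).mono hIco)
    refine ⟨?_, ?_, ?_, ?_⟩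
    · rw [show bv k = fun t => -((1 + ε₀) ^ ((k : ℝ) / 2) * Y 0 k t) from funext (hbv k)]
      exact (continuousOn_const.mul (hYk 0)).neg
    · rw [show wv k = fun t => (1 + ε₀) ^ ((k : ℝ) / 2) * Y 1 k t from funext (hwv k)]
      exact continuousOn_const.mul (hYk 1)
    · rw [show M0 k = _ from funext (hM0 k)]
      exact continuousOn_const.mul
        ((continuousOn_const.mul ((hKc 0 k).continuousOn)).add (hV 0))
    · rw [show M1 k = _ from funext (hM1 k)]
      exact continuousOn_const.mul (hV 1)
  · -- the carrier equation
    intro k t ht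
    have hf := chainCritical_hasDerivAt_explicit hK hK₁ hK0 hYc hchainK 0 k hTS ht
    have hest := chainCritical_explicit_estimate hε₀ hK hK₁ hK0 hpinch hsum hdiff hYc hchainK 0 k hTS ht
    rw [ha0] at hest
    have hkey : -(1 + ε₀) ^ ((k : ℝ) / 2) * quadTerm ε₀ α Y 0 k t = R k * G0 k t := by
      rw [neg_mul]
      exact hkey0 k t
    obtain ⟨e, he, hd⟩ := chainCritical_exists_error hf hest hkey
    refine ⟨e, ?_, ?_⟩
    · rw [hM0]
      rwa [abs_neg, abs_of_pos (hP k)] at he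
    · rw [show bv k = fun u => -(1 + ε₀) ^ ((k : ℝ) / 2) * Y 0 k u from
        funext fun u => by rw [hbv, neg_mul]]
      exact hd
  · -- the bond equation
    intro k t ht
    have hf := chainCritical_hasDerivAt_explicit hK hK₁ hK0 hYc hchainK 1 k hTS ht
    have hest := chainCritical_explicit_estimate hε₀ hK hK₁ hK0 hpinch hsum hdiff hYc hchainK 1 k hTS ht
    simp only [ha1, abs_zero, zero_mul, zero_add] at hf hest
    obtain ⟨e, he, hd⟩ := chainCritical_exists_error hf hest (hkey1 k t)
    refine ⟨e, ?_, ?_⟩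
    · rw [hM1]
      rwa [abs_of_pos (hP k)] at he
    · rw [show wv k = fun u => (1 + ε₀) ^ ((k : ℝ) / 2) * Y 1 k u from funext (hwv k)]
      exact hd
  · -- the majorants dominate
    intro k t ht
    have htS : t ∈ Ico 0 S := hIco ht
    obtain ⟨hb0, hnn0⟩ := chainCritical_abs_le_majorant (hKc 0 k) (hKnn 0 k) (hQc 0 k) htS (hchainK 0 k t htS)
    obtain ⟨hb1, hnn1⟩ := chainCritical_abs_le_majorant (hKc 1 k) (hKnn 1 k) (hQc 1 k) htS (hchainK 1 k t htS)
    rw [ha0] at hb0 hnn0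
    simp only [ha1, abs_zero, zero_mul, zero_add] at hb1 hnn1
    rw [hbv, hwv, hM0, hM1, abs_neg, abs_mul, abs_mul, abs_of_pos (hP k)]
    exact ⟨mul_le_mul_of_nonneg_left hb0 (hP k).le, mul_le_mul_of_nonneg_left hb1 (hP k).le,
      mul_nonneg (hP k).le hnn0, mul_nonneg (hP k).le hnn1⟩
  · -- the restart inequality
    intro k t₁ ht₁ t₂ ht₂
    have hD : ∀ (i : Fin 2) (τ : ℝ), 0 ≤ τ → θ * R k * K i k τ ≤ -(-K₁ i k τ) := fun i τ hτ => by
      rw [neg_neg, ← hθ]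
      exact (hpinch i k τ hτ).2.1
    have r0 := chainCritical_majorant_restart (hK 0 k) (hD 0) (hK0 0 k) ((hQc 0 k).mono hIco)
      (a := if k = n₀ then |A| else 0) (by positivity) ht₁.1 ht₂.1 ht₂.2
    have r1 := chainCritical_majorant_restart (hK 1 k) (hD 1) (hK0 1 k) ((hQc 1 k).mono hIco)
      (a := 0) le_rfl ht₁.1 ht₂.1 ht₂.2
    simp only [zero_mul, zero_add] at r1
    have hPQ0 : ∀ u, (1 + ε₀) ^ ((k : ℝ) / 2) * |quadTerm ε₀ α Y 0 k u| = R k * |G0 k u| := by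
      intro u
      have h := congrArg abs (hkey0 k u)
      rwa [abs_neg, abs_mul, abs_mul, abs_of_pos (hP k), abs_of_pos (hRpos k)] at h
    have hPQ1 : ∀ u, (1 + ε₀) ^ ((k : ℝ) / 2) * |quadTerm ε₀ α Y 1 k u| = R k * |G1 k u| := by
      intro u
      have h := congrArg abs (hkey1 k u)
      rwa [abs_mul, abs_mul, abs_of_pos (hP k), abs_of_pos (hRpos k)] at h
    have hconv0 : (1 + ε₀) ^ ((k : ℝ) / 2) *
        ∫ u in t₁..t₂, Real.exp (-(θ * R k * (t₂ - u))) * |quadTerm ε₀ α Y 0 k u| =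
        R k * ∫ u in t₁..t₂, Real.exp (-(θ * R k * (t₂ - u))) * |G0 k u| := by
      rw [← intervalIntegral.integral_const_mul, ← intervalIntegral.integral_const_mul]
      refine intervalIntegral.integral_congr fun u _ => ?_
      linear_combination Real.exp (-(θ * R k * (t₂ - u))) * hPQ0 u
    have hconv1 : (1 + ε₀) ^ ((k : ℝ) / 2) *
        ∫ u in t₁..t₂, Real.exp (-(θ * R k * (t₂ - u))) * |quadTerm ε₀ α Y 1 k u| =
        R k * ∫ u in t₁..t₂, Real.exp (-(θ * R k * (t₂ - u))) * |G1 k u| := by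
      rw [← intervalIntegral.integral_const_mul, ← intervalIntegral.integral_const_mul]
      refine intervalIntegral.integral_congr fun u _ => ?_
      linear_combination Real.exp (-(θ * R k * (t₂ - u))) * hPQ1 u
    simp only [hM0, hM1]
    constructor
    · refine (mul_le_mul_of_nonneg_left r0 (hP k).le).trans_eq ?_
      rw [mul_add, hconv0]
      ring
    · refine (mul_le_mul_of_nonneg_left r1 (hP k).le).trans_eq ?_
      rw [mul_add, hconv1]
      ring
  · -- `M0` at time `0`, scale `n₀`
    rw [hM0, if_pos rfl, hK0, intervalIntegral.integral_same]
    ring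
  · -- `M0` at time `0`, other scales
    intro k hk
    rw [hM0, if_neg hk, intervalIntegral.integral_same]
    ring
  · -- `M1` at time `0`
    intro k
    rw [hM1, intervalIntegral.integral_same, mul_zero]

/-! ### The registered stub -/

/-- **Stub `chainCritical`** (the Layer-1 → Layer-2 bridge of line `Sketch`, tree vocabulary). For thin
wavelet data (radius `≤ r`, centres on `|ξ| = 1 + ε₀/4`) and the seeded Toda structure constants with Toda
coupling `D_c = 4π²(ρ₀² + r²)` and seed `ε̄ D_c`, a continuous solution of the exact Volterra chain from the
carrier datum `A` at scale `n₀` is, in the critical variables `b_n = −(1+ε₀)^{n/2} Y₀,ₙ`,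
`w_n = (1+ε₀)^{n/2} Y₁,ₙ` and with the critical kernel-majorants `M`, a solution of the critical Toda
system with memory errors: rates `R_n = D_c(1+ε₀)^{2n}`, `b' = R(−b + w₋²/q³ − w² − ε̄bw) + e`,
`w' = R(−w + w(b − b₊/q) + ε̄b²) + e`, `|e| ≤ ηRM`, `η = 2ρ₀r/(ρ₀²+r²)`, `|b| ≤ M`, and the restart
inequality of the majorants at rate `θR`, `θ = (ρ₀−r)²/(ρ₀²+r²)` (`stub_kernelDeriv`, `stub_chainODE`,
`stub_todaLegal`, and the logarithmic decay of the pinched kernels). [cite: Tao2016AveragedNS, §4 p. 22 (4.14)] -/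
theorem stub_chainCritical :
    ∀ {ε₀ : ℝ}, 0 < ε₀ → ε₀ ≤ 1 → ∀ (𝒟 : CascadeWaveletData ε₀ 2) (r : ℝ), 0 < r → r ≤ (1 + ε₀ / 4) / 2 →
      (∀ i, 𝒟.radius i ≤ r ∧ ‖𝒟.center i‖ = 1 + ε₀ / 4) →
      ∀ (Dc εb : ℝ) (n₀ : ℤ) (A S : ℝ) (Y : Fin 2 → ℤ → ℝ → ℝ),
      Dc = 4 * Real.pi ^ 2 * ((1 + ε₀ / 4) ^ 2 + r ^ 2) → 0 < S →
      (∀ i n, ContinuousOn (Y i n) (Ico 0 S)) →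
      (∀ i n t, n < n₀ → Y i n t = 0) →
      (∀ (i : Fin 2) (n : ℤ), ∀ t ∈ Ico 0 S,
        Y i n t = (if i = 0 ∧ n = n₀ then A else 0) *
            (pairing (heat t (cascadeWavelet ε₀ (𝒟.ψ i) n)) (cascadeWavelet ε₀ (𝒟.ψ i) n)).re +
          ∫ s in (0 : ℝ)..t,
            (pairing (heat (t - s) (cascadeWavelet ε₀ (𝒟.ψ i) n)) (cascadeWavelet ε₀ (𝒟.ψ i) n)).re *
              quadTerm ε₀ (fun (i₁ i₂ i₃ : Fin 2) (μ : ℤ × ℤ × ℤ) =>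
          if i₁ = 1 ∧ i₂ = 1 ∧ i₃ = 0 ∧ μ = (0, 0, 0) then Dc else
          if i₁ = 1 ∧ i₂ = 0 ∧ i₃ = 1 ∧ μ = (0, 0, 0) then -Dc / 2 else
          if i₁ = 0 ∧ i₂ = 1 ∧ i₃ = 1 ∧ μ = (0, 0, 0) then -Dc / 2 else
          if i₁ = 1 ∧ i₂ = 0 ∧ i₃ = 1 ∧ μ = (0, 1, 0) then Dc / 2 else
          if i₁ = 0 ∧ i₂ = 1 ∧ i₃ = 1 ∧ μ = (1, 0, 0) then Dc / 2 else
          if i₁ = 1 ∧ i₂ = 1 ∧ i₃ = 0 ∧ μ = (0, 0, 1) then -Dc else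
          if i₁ = 0 ∧ i₂ = 0 ∧ i₃ = 1 ∧ μ = (0, 0, 0) then εb * Dc else
          if i₁ = 0 ∧ i₂ = 1 ∧ i₃ = 0 ∧ μ = (0, 0, 0) then -(εb * Dc) / 2 else
          if i₁ = 1 ∧ i₂ = 0 ∧ i₃ = 0 ∧ μ = (0, 0, 0) then -(εb * Dc) / 2 else 0) Y i n s) →
      let θ : ℝ := (1 + ε₀ / 4 - r) ^ 2 / ((1 + ε₀ / 4) ^ 2 + r ^ 2)
      let η : ℝ := 2 * (1 + ε₀ / 4) * r / ((1 + ε₀ / 4) ^ 2 + r ^ 2)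
      let q : ℝ := Real.sqrt (1 + ε₀)
      let R : ℤ → ℝ := fun k => Dc * (1 + ε₀) ^ (2 * k)
      let K : Fin 2 → ℤ → ℝ → ℝ := fun i n τ => ∫ ξ, Real.exp (-(heatRate ξ * τ)) * modeWeight 𝒟 i n ξ
      let bv : ℤ → ℝ → ℝ := fun n t => -((1 + ε₀) ^ ((n : ℝ) / 2) * Y 0 n t)
      let wv : ℤ → ℝ → ℝ := fun n t => (1 + ε₀) ^ ((n : ℝ) / 2) * Y 1 n t
      let G0 : ℤ → ℝ → ℝ := fun k t => (wv (k - 1) t) ^ 2 / q ^ 3 - (wv k t) ^ 2 - εb * bv k t * wv k t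
      let G1 : ℤ → ℝ → ℝ := fun k t => wv k t * (bv k t - bv (k + 1) t / q) + εb * (bv k t) ^ 2
      let M0 : ℤ → ℝ → ℝ := fun n t => (1 + ε₀) ^ ((n : ℝ) / 2) *
        ((if n = n₀ then |A| else 0) * K 0 n t + ∫ s in (0 : ℝ)..t, K 0 n (t - s) * |quadTerm ε₀ (fun (i₁ i₂ i₃ : Fin 2) (μ : ℤ × ℤ × ℤ) =>
          if i₁ = 1 ∧ i₂ = 1 ∧ i₃ = 0 ∧ μ = (0, 0, 0) then Dc else
          if i₁ = 1 ∧ i₂ = 0 ∧ i₃ = 1 ∧ μ = (0, 0, 0) then -Dc / 2 else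
          if i₁ = 0 ∧ i₂ = 1 ∧ i₃ = 1 ∧ μ = (0, 0, 0) then -Dc / 2 else
          if i₁ = 1 ∧ i₂ = 0 ∧ i₃ = 1 ∧ μ = (0, 1, 0) then Dc / 2 else
          if i₁ = 0 ∧ i₂ = 1 ∧ i₃ = 1 ∧ μ = (1, 0, 0) then Dc / 2 else
          if i₁ = 1 ∧ i₂ = 1 ∧ i₃ = 0 ∧ μ = (0, 0, 1) then -Dc else
          if i₁ = 0 ∧ i₂ = 0 ∧ i₃ = 1 ∧ μ = (0, 0, 0) then εb * Dc else
          if i₁ = 0 ∧ i₂ = 1 ∧ i₃ = 0 ∧ μ = (0, 0, 0) then -(εb * Dc) / 2 else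
          if i₁ = 1 ∧ i₂ = 0 ∧ i₃ = 0 ∧ μ = (0, 0, 0) then -(εb * Dc) / 2 else 0) Y 0 n s|)
      let M1 : ℤ → ℝ → ℝ := fun n t => (1 + ε₀) ^ ((n : ℝ) / 2) *
        (∫ s in (0 : ℝ)..t, K 1 n (t - s) * |quadTerm ε₀ (fun (i₁ i₂ i₃ : Fin 2) (μ : ℤ × ℤ × ℤ) =>
          if i₁ = 1 ∧ i₂ = 1 ∧ i₃ = 0 ∧ μ = (0, 0, 0) then Dc else
          if i₁ = 1 ∧ i₂ = 0 ∧ i₃ = 1 ∧ μ = (0, 0, 0) then -Dc / 2 else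
          if i₁ = 0 ∧ i₂ = 1 ∧ i₃ = 1 ∧ μ = (0, 0, 0) then -Dc / 2 else
          if i₁ = 1 ∧ i₂ = 0 ∧ i₃ = 1 ∧ μ = (0, 1, 0) then Dc / 2 else
          if i₁ = 0 ∧ i₂ = 1 ∧ i₃ = 1 ∧ μ = (1, 0, 0) then Dc / 2 else
          if i₁ = 1 ∧ i₂ = 1 ∧ i₃ = 0 ∧ μ = (0, 0, 1) then -Dc else
          if i₁ = 0 ∧ i₂ = 0 ∧ i₃ = 1 ∧ μ = (0, 0, 0) then εb * Dc else
          if i₁ = 0 ∧ i₂ = 1 ∧ i₃ = 0 ∧ μ = (0, 0, 0) then -(εb * Dc) / 2 else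
          if i₁ = 1 ∧ i₂ = 0 ∧ i₃ = 0 ∧ μ = (0, 0, 0) then -(εb * Dc) / 2 else 0) Y 1 n s|)
      ∀ T : ℝ, 0 < T → T < S →
        (∀ k : ℤ, k < n₀ → ∀ t ∈ Icc 0 T, bv k t = 0 ∧ wv k t = 0 ∧ M0 k t = 0 ∧ M1 k t = 0) ∧
        (∀ k : ℤ, ContinuousOn (bv k) (Icc 0 T) ∧ ContinuousOn (wv k) (Icc 0 T) ∧
          ContinuousOn (M0 k) (Icc 0 T) ∧ ContinuousOn (M1 k) (Icc 0 T)) ∧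
        (∀ k : ℤ, ∀ t ∈ Ioo 0 T, ∃ e : ℝ, |e| ≤ η * R k * M0 k t ∧
          HasDerivAt (bv k) (R k * (-(bv k t) + G0 k t) + e) t) ∧
        (∀ k : ℤ, ∀ t ∈ Ioo 0 T, ∃ e : ℝ, |e| ≤ η * R k * M1 k t ∧
          HasDerivAt (wv k) (R k * (-(wv k t) + G1 k t) + e) t) ∧
        (∀ k : ℤ, ∀ t ∈ Icc 0 T, |bv k t| ≤ M0 k t ∧ |wv k t| ≤ M1 k t ∧ 0 ≤ M0 k t ∧ 0 ≤ M1 k t) ∧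
        (∀ k : ℤ, ∀ t₁ ∈ Icc 0 T, ∀ t₂ ∈ Icc t₁ T,
          M0 k t₂ ≤ M0 k t₁ * Real.exp (-(θ * R k * (t₂ - t₁))) +
            R k * ∫ u in t₁..t₂, Real.exp (-(θ * R k * (t₂ - u))) * |G0 k u| ∧
          M1 k t₂ ≤ M1 k t₁ * Real.exp (-(θ * R k * (t₂ - t₁))) +
            R k * ∫ u in t₁..t₂, Real.exp (-(θ * R k * (t₂ - u))) * |G1 k u|) ∧
        (M0 n₀ 0 = (1 + ε₀) ^ ((n₀ : ℝ) / 2) * |A| ∧ ∀ k : ℤ, k ≠ n₀ → M0 k 0 = 0) ∧ (∀ k : ℤ, M1 k 0 = 0) := by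
  intro ε₀ hε₀ hε₁ 𝒟 r hr hr2 hD Dc εb n₀ A S Y hDc hS hYc hlow hchain θ η q R K bv wv G0 G1 M0 M1 T hT hTS
  have hrρ : r < 1 + ε₀ / 4 := by linarith
  have hKD := fun i n => stub_kernelDeriv hε₀ hε₁ 𝒟 (1 + ε₀ / 4) r hr hrρ hD i n
  obtain ⟨-, -, hQ⟩ := stub_todaLegal Dc (εb * Dc)
  have hρr : 0 < (1 + ε₀ / 4) ^ 2 + r ^ 2 := by positivity
  have hDc0 : 0 < Dc := by rw [hDc]; positivity
  exact chainCritical_of_kernels (θ := θ) (η := η) (q := q) (R := R) (K := K) (bv := bv) (wv := wv)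
    (G0 := G0) (G1 := G1) (M0 := M0) (M1 := M1) hε₀
    (κ := fun i n τ => (pairing (heat τ (cascadeWavelet ε₀ (𝒟.ψ i) n)) (cascadeWavelet ε₀ (𝒟.ψ i) n)).re)
    (K₁ := fun i n τ => ∫ ξ, heatRate ξ * Real.exp (-(heatRate ξ * τ)) * modeWeight 𝒟 i n ξ)
    (Dlo := fun n => 4 * Real.pi ^ 2 * (1 + ε₀ / 4 - r) ^ 2 * (1 + ε₀) ^ (2 * n))
    (Dhi := fun n => 4 * Real.pi ^ 2 * (1 + ε₀ / 4 + r) ^ 2 * (1 + ε₀) ^ (2 * n))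
    (fun i n τ hτ => (hKD i n).1 τ hτ) (fun i n τ => (hKD i n).2.1 τ) (fun i n => (hKD i n).2.2.1)
    (fun i n => ((hKD i n).1 0 le_rfl).symm.trans (stub_kernel hε₀ hε₁ 𝒟 i n).1)
    (fun i n τ hτ => (hKD i n).2.2.2 τ hτ)
    (fun n => by
      show 4 * Real.pi ^ 2 * (1 + ε₀ / 4 - r) ^ 2 * (1 + ε₀) ^ (2 * n) +
          4 * Real.pi ^ 2 * (1 + ε₀ / 4 + r) ^ 2 * (1 + ε₀) ^ (2 * n) = 2 * (Dc * (1 + ε₀) ^ (2 * n))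
      rw [hDc]; ring)
    (fun n => by
      show 4 * Real.pi ^ 2 * (1 + ε₀ / 4 + r) ^ 2 * (1 + ε₀) ^ (2 * n) -
          4 * Real.pi ^ 2 * (1 + ε₀ / 4 - r) ^ 2 * (1 + ε₀) ^ (2 * n) =
        2 * (2 * (1 + ε₀ / 4) * r / ((1 + ε₀ / 4) ^ 2 + r ^ 2) * (Dc * (1 + ε₀) ^ (2 * n)))
      rw [hDc]; field_simp; ring)
    (fun n => by
      show 4 * Real.pi ^ 2 * (1 + ε₀ / 4 - r) ^ 2 * (1 + ε₀) ^ (2 * n) =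
        (1 + ε₀ / 4 - r) ^ 2 / ((1 + ε₀ / 4) ^ 2 + r ^ 2) * (Dc * (1 + ε₀) ^ (2 * n))
      rw [hDc]; field_simp)
    hDc0 (fun _ => rfl) rfl hYc hlow hchain (fun n t => (hQ ε₀ Y n t).1) (fun n t => (hQ ε₀ Y n t).2)
    (fun _ _ => rfl) (fun _ _ => rfl) (fun _ _ => rfl) (fun _ _ => rfl) (fun _ _ => rfl)
    (fun _ _ => rfl) hT hTS

end Summit.NavierStokesRegularity.NavierStokesRegularity.Theorems.PerpetualPumpAveragedTypeIBlowup

end
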